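import Summits.BirchSwinnertonDyer.Rank1Residual.Additive.X4RankZeroUpperBoundThree
import Summits.BirchSwinnertonDyer.Rank1Residual.Additive.X4RankZeroTamagawaParity
import Summits.BirchSwinnertonDyer.Rank1Residual.Additive.SemistableTwistTowerThree
import Summits.BirchSwinnertonDyer.Rank1Residual.AdditivePotMult.ManinConstantDegree
import Summits.BirchSwinnertonDyer.Rank1Residual.X11b.MultiplicativeSurjectivityTwist
import HarnessLib

/-!
# X4(M), rank `0`, `p = 3`: a SECOND published upper-half road — Kim–Nakamura 2020 at the ADDITIVE
# prime itself, with the `3`-adic tower and the Manin binder DISCHARGED on (M) (cell `b2b-bsdres`,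
# sub-cell additive-p1, gen 18)

HONEST FRAMING (cell `b2b-bsdres`, run/shared/lean/b2b/bsd-rank1-residual/, verbatim in every
file): the goal of the cell is to DELETE the COMBINATION-SHAPED residual classes of the
Birch–Swinnerton-Dyer formula for ALL analytic-rank `≤ 1` elliptic curves over `ℚ` — "full BSD
formula for every rank `≤ 1` curve in class `C`" assembled STRICTLY from published theorems — so
that the rank-`≤ 1` remainder becomes exactly the CONSTRUCTION-SHAPED classes, which are TYPED
(missing-input `Prop`s), NOT attempted. This is not "finishing BSD". Sub-cell additive-p1
(X3♯(M) / X4(M): additive, potentially MULTIPLICATIVE prime) is a research route; X3♯(M) and X4(M)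
stay CONSTRUCTION-SHAPED; nothing is booked by this file (the lane books, the referee signs); the
census numbers quoted are EVIDENCE pointers (rmap-2 `census/kn20_bits_rmap2g3.md`), never inputs.
THEOREMS ONLY (no definition, no named fact, no `sorry`).

## What this file does

On the (M) rows at `p = 3` in analytic rank `0` (RESIDUAL-MAP §I N10 (M) / N11; 82 196 S-b pairs)
the cell's road of record for the UPPER half `ord₃ #Ш(E) ≤ ord₃ #Ш(E)_an` is the gen-9 chain
Delbourgo 1998 Prop. 4 ∘ [C] ∘ Kato's divisibility on the `ω`-component for the MULTIPLICATIVE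
twist `E♭ = E^{(−3)}` (named fact A136 `Wuthrich2014.kato_halfEigenCharIdeal_dvd_cyclotomicPrime_of_surjective`,
booked LITERAL under the reading flag `Wu14-surj-attribution`). There is a second printed road that
works AT THE ADDITIVE PRIME ITSELF and never mentions `E♭`: Kim–Nakamura, J. Number Theory 210
(2020), Thm. 1.7 + Rem. 1.8 (1) in its INEQUALITY form (named fact A153
`KimNakamura2020.rankZero_padicValNat_sha_le_of_maninConstant`, typed by the cell's lit-kato seat;
Kato's Euler system over `ℚ` + Rubin's Kolyvagin-system bound + Kosters–Pannekoek at the additive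
`p`; consumer `Additive/X4RankZeroUpperBoundThree.lean` of additive-p4 over the class predicate
`ClassX4`). Its per-pair binders are: the `3`-adic TOWER `∀ n, ρ̄_{E,3ⁿ}` onto, NOT exceptional
(Assumption 2.5), `3 ∤ ∏ c_ℓ · ∏_{ℓ ∣ N_st}(ℓ − 1) · ∏_{ℓ ∣ N_ns}(ℓ + 1)` (Assumption 1.1 (1)), and a
modular parametrisation with `3 ∤ c` (Assumption 1.1 (3)).

On X4(M) two of these binders are THEOREMS of the tree, which this file threads in:
* the TOWER: `ClassX4M.towerSurj_of_surj` (n1011-p14, `Additive/SemistableTwistTowerThree.lean`: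
  the multiplicative twist model is `3`-adically surjective by the PROVED Lemma 20 of Wuthrich 2014,
  and a quadratic twist changes `ρ̄_{E,3ⁿ}` by a sign) — surj(3) ALONE gives the tower on (M), and
  surj(3) itself is decided in the kernel by `3 ∤ ord₃ j(E)` (`ClassX4M.surj_of_not_dvd_padicValRat_j`,
  très ramifié);
* the MANIN binder: `ClassX4M.not_dvd_maninConstant_of_not_dvd_modularDegree` (this sub-cell, gen 14:
  Česnavičius–Neururer–Saha 2024 Thm. 1.2 `hCNS` = A159 + TAMENESS of (M), `f₃ = 2`) — `3 ∤ deg φ` for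
  ANY conductor-level parametrisation replaces `3 ∤ c` (no optimality, Cremona's `degphi`).

§1 `ClassX4M.missingUpperBoundAt_three_rankZero_of_kimNakamura_of_surj` — the typed UPPER half on
X4(M) ∧ surj(3) ∧ non-exceptional ∧ `3 ∤ ∏ c_ℓ · ∏(ℓ ∓ 1)` ∧ `3 ∤ c_D`, from A153 + GZK + modularity;
`…_of_not_dvd_padicValRat_j` (surj(3) ⇐ `3 ∤ ord₃ j`); `…_of_not_dvd_modularDegree` (Manin-free, `hCNS`).
§2 `BSD(E,3)` on the unit rows (`3 ∤ #Ш_an`): `ClassX4M.bsdp_three_rankZero_of_kimNakamura_of_surj_of_shaAn_unit`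
and its `j` / modular-degree forms; on the `3 ∣ #Ш_an` rows with ONE descent certificate
`3^{2k−1} ∣ #Ш(E)` (Cassels–Tate squareness `hCT`): `…_of_casselsTate_of_pow_dvd`.
§3 `MissingInputAt ⟺ lower half` bookkeeping on the KN20 locus (the CONSTRUCTION-SHAPED input that is
left is the LOWER half, exactly as on the Delbourgo–Kato road).

What this is NOT: not a class theorem (per-pair binders: non-exceptionality, the `(ℓ ∓ 1)` units,
`3 ∤ ∏ c_ℓ`); not flag-free (A153 is a READING-fact: `KN20-p≤7-by-Remark-1.8(1)`,
`KN20-inequality-packaging`); it touches the same cells as the PMX booking (literal) — its value is a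
second, INDEPENDENT printed source for the upper half on the sub-population where KN20's provisos
hold (rmap-2 gen 3 two-engine census `kn20_bits_rmap2g3.md`: of the 82 196 (M)@3 `r = 0` pairs,
20 043 pass the `(ℓ ∓ 1)` clause, 41 205 are non-exceptional, 6 906 pass every KN20 bit; EVIDENCE,
not an input). The companion file-half (gen 18, after the Literature append A153′ lands) replaces the
`(ℓ ∓ 1)` clause by the `N`-imprimitive defect `Σ ord₃(ℓ − a_ℓ)` and closes the defect-`1` rows by
Cassels–Tate parity.

References: Kim–Nakamura 2020 [KimNakamura2020] Thm. 1.7, Rem. 1.8 (1), Thm. 4.2 (2), (4.3), Cor. 2.4,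
Assumption 1.1 / 2.5; Wuthrich 2014 [Wuthrich2014] Lemma 20 (p. 399); Česnavičius–Neururer–Saha 2024
[CesnaviciusNeururerSaha2023] Thm. 1.2; Silverman *AEC* X.4.14 (Cassels–Tate), *ATAEC* V.5.3 / V.6.1;
Miller 2011 [Miller2011LMS] Def. 1.1; Gross–Zagier–Kolyvagin (bsd.S17); modularity (BCDT).
-/

noncomputable section

open scoped Classical

open WeierstrassCurve Literature.NumberTheory.EllipticCurves
  Literature.NumberTheory.EllipticCurves.ModularForms
  Literature.NumberTheory.EllipticCurves.Rank1Residual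
  Literature.NumberTheory.EllipticCurves.Rank1Residual.Typed

namespace Summit.BirchSwinnertonDyer.Rank1Residual.AdditivePotMult

section ClassX4M

open Additive GaloisImage

variable {W : WeierstrassCurve ℚ} [W.IsElliptic] [W.IsGloballyMinimal]

/-! ### §1 The typed UPPER half on X4(M) at `3` from Kim–Nakamura, tower and Manin discharged -/

/-- **X4(M) ∧ surj(3) ∧ `r_an = 0`: `MissingUpperBoundAt W 3` (`ord₃ #Ш(E) ≤ ord₃ #Ш(E)_an`) from
Kim–Nakamura 2020 at the additive prime `3` itself** — per-pair binders: NOT exceptional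
(Assumption 2.5, `KimNakamura2020.NonExceptional W 3`), `3 ∤ ∏ c_ℓ`, the `(ℓ ∓ 1)` clause of
Assumption 1.1 (1), a parametrisation datum `D` with `3 ∤ c_D`. The `3`-adic tower binder of the
additive-p4 consumer `X4RankZero.missingUpperBoundAt_three_of_kimNakamura` is DISCHARGED on (M) by
`ClassX4M.towerSurj_of_surj` (surj(3) alone; Wuthrich Lemma 20 PROVED on the multiplicative twist and
transported along the twist). Named facts: `hKN` (A153), `hGZK`, `hmod`.
[cite: KimNakamura2020, Thm. 1.7 and Rem. 1.8 (1) (arXiv p. 4); Thm. 4.2 (2), (4.3) (arXiv p. 9); Cor. 2.4, Assumption 2.5 (arXiv p. 5)]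
[cite: Wuthrich2014, Lemma 20 (p. 399)] [cite: Miller2011LMS, Def. 1.1] -/
theorem ClassX4M.missingUpperBoundAt_three_rankZero_of_kimNakamura_of_surj
    (hKN : KimNakamura2020.rankZero_padicValNat_sha_le_of_maninConstant)
    (hGZK : rank_eq_analyticRank_of_analyticRank_le_one) (hmod : hasEntireLFunction_rat)
    (hX : ClassX4M W 3) (hsurj : Surj W 3) (hr : W.analyticRank = 0)
    (hexc : KimNakamura2020.NonExceptional W 3)
    (hmult : ∀ (ℓ : ℕ) [Fact ℓ.Prime], W.HasMultiplicativeReductionAtPrime ℓ →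
      (W.HasSplitMultiplicativeReductionAtPrime ℓ → ¬ 3 ∣ ℓ - 1) ∧
        (¬ W.HasSplitMultiplicativeReductionAtPrime ℓ → ¬ 3 ∣ ℓ + 1))
    {N : ℕ} [NeZero N] (D : ModularParametrizationData W N) (hc : ¬ (3 : ℤ) ∣ D.maninConstant)
    (htam : ¬ 3 ∣ W.tamagawaProduct) : MissingUpperBoundAt W 3 :=
  haveI : Fact (Nat.Prime 3) := ⟨Nat.prime_three⟩
  X4RankZero.missingUpperBoundAt_three_of_kimNakamura W hKN hGZK hmod hr hX.classX4
    (ClassX4M.towerSurj_of_surj hX hsurj) hexc hmult D hc htam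

/-- **§1, `j`-form: surj(3) decided in the kernel by `3 ∤ ord₃ j(E)`** (très ramifié:
`ClassX4M.surj_of_not_dvd_padicValRat_j`, Silverman *ATAEC* V.6.1 / V.5.3) — the upper half on
X4(M) ∧ `3 ∤ ord₃ j` ∧ `r_an = 0` with the KN20 per-pair binders.
[cite: KimNakamura2020, Thm. 1.7 and Rem. 1.8 (1) (arXiv p. 4)] [cite: SilvermanATAEC1994, V.6 Prop. 6.1 (p. 410) and V.5.3]
[cite: Miller2011LMS, Def. 1.1] -/
theorem ClassX4M.missingUpperBoundAt_three_rankZero_of_kimNakamura_of_not_dvd_padicValRat_j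
    (hKN : KimNakamura2020.rankZero_padicValNat_sha_le_of_maninConstant)
    (hGZK : rank_eq_analyticRank_of_analyticRank_le_one) (hmod : hasEntireLFunction_rat)
    (hX : ClassX4M W 3) (hj : ¬ (3 : ℤ) ∣ padicValRat 3 W.j) (hr : W.analyticRank = 0)
    (hexc : KimNakamura2020.NonExceptional W 3)
    (hmult : ∀ (ℓ : ℕ) [Fact ℓ.Prime], W.HasMultiplicativeReductionAtPrime ℓ →
      (W.HasSplitMultiplicativeReductionAtPrime ℓ → ¬ 3 ∣ ℓ - 1) ∧
        (¬ W.HasSplitMultiplicativeReductionAtPrime ℓ → ¬ 3 ∣ ℓ + 1))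
    {N : ℕ} [NeZero N] (D : ModularParametrizationData W N) (hc : ¬ (3 : ℤ) ∣ D.maninConstant)
    (htam : ¬ 3 ∣ W.tamagawaProduct) : MissingUpperBoundAt W 3 :=
  haveI : Fact (Nat.Prime 3) := ⟨Nat.prime_three⟩
  hX.missingUpperBoundAt_three_rankZero_of_kimNakamura_of_surj hKN hGZK hmod
    (ClassX4M.surj_of_not_dvd_padicValRat_j hX (by exact_mod_cast hj)) hr hexc hmult D hc htam

/-- **§1, Manin-free form: `3 ∤ deg φ` for ANY conductor-level parametrisation replaces `3 ∤ c`**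
(Česnavičius–Neururer–Saha 2024 Thm. 1.2 `hCNS` = A159 + tameness of (M):
`ClassX4M.not_dvd_maninConstant_of_not_dvd_modularDegree`). [cite: CesnaviciusNeururerSaha2023, Thm. 1.2]
[cite: KimNakamura2020, Thm. 1.7 and Rem. 1.8 (1) (arXiv p. 4)] [cite: Miller2011LMS, Def. 1.1] -/
theorem ClassX4M.missingUpperBoundAt_three_rankZero_of_kimNakamura_of_surj_of_not_dvd_modularDegree
    (hKN : KimNakamura2020.rankZero_padicValNat_sha_le_of_maninConstant)
    (hCNS : cesnaviciusNeururerSaha_padicVal_maninConstant_le_modularDegree)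
    (hGZK : rank_eq_analyticRank_of_analyticRank_le_one) (hmod : hasEntireLFunction_rat)
    (hX : ClassX4M W 3) (hsurj : Surj W 3) (hr : W.analyticRank = 0)
    (hexc : KimNakamura2020.NonExceptional W 3)
    (hmult : ∀ (ℓ : ℕ) [Fact ℓ.Prime], W.HasMultiplicativeReductionAtPrime ℓ →
      (W.HasSplitMultiplicativeReductionAtPrime ℓ → ¬ 3 ∣ ℓ - 1) ∧
        (¬ W.HasSplitMultiplicativeReductionAtPrime ℓ → ¬ 3 ∣ ℓ + 1))
    [NeZero (W.conductorNorm ℤ)] (D : ModularParametrizationData W (W.conductorNorm ℤ))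
    (hdeg : ¬ 3 ∣ D.modularDegree) (htam : ¬ 3 ∣ W.tamagawaProduct) : MissingUpperBoundAt W 3 :=
  haveI : Fact (Nat.Prime 3) := ⟨Nat.prime_three⟩
  hX.missingUpperBoundAt_three_rankZero_of_kimNakamura_of_surj hKN hGZK hmod hsurj hr hexc hmult D
    (ClassX4M.not_dvd_maninConstant_of_not_dvd_modularDegree hCNS D hX hdeg) htam

/-! ### §2 `BSD(E,3)` on the KN20 locus of X4(M): unit rows, and `3 ∣ #Ш_an` rows with a certificate -/

/-- **X4(M) ∧ surj(3) ∧ `r_an = 0` ∧ non-exceptional ∧ `3 ∤ ∏ c_ℓ · ∏(ℓ ∓ 1)` ∧ `3 ∤ c_D` ∧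
`3 ∤ #Ш(E)_an` ⟹ `BSD(E,3)`** — the unit rows: KN20's upper half (§1) forces `Ш(E)[3^∞] = 0`, and
`ord₃ #Ш_an = 0` is the datum. Published inputs A153 (`hKN`), GZK, modularity; per-pair certificates
only otherwise. [cite: KimNakamura2020, Thm. 1.7 and Rem. 1.8 (1) (arXiv p. 4); Cor. 2.4, Assumption 2.5 (arXiv p. 5)]
[cite: Wuthrich2014, Lemma 20 (p. 399)] [cite: Miller2011LMS, §1 and Def. 1.1] -/
theorem ClassX4M.bsdp_three_rankZero_of_kimNakamura_of_surj_of_shaAn_unit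
    (hKN : KimNakamura2020.rankZero_padicValNat_sha_le_of_maninConstant)
    (hGZK : rank_eq_analyticRank_of_analyticRank_le_one) (hmod : hasEntireLFunction_rat)
    (hX : ClassX4M W 3) (hsurj : Surj W 3) (hr : W.analyticRank = 0)
    (hexc : KimNakamura2020.NonExceptional W 3)
    (hmult : ∀ (ℓ : ℕ) [Fact ℓ.Prime], W.HasMultiplicativeReductionAtPrime ℓ →
      (W.HasSplitMultiplicativeReductionAtPrime ℓ → ¬ 3 ∣ ℓ - 1) ∧
        (¬ W.HasSplitMultiplicativeReductionAtPrime ℓ → ¬ 3 ∣ ℓ + 1))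
    {N : ℕ} [NeZero N] (D : ModularParametrizationData W N) (hc : ¬ (3 : ℤ) ∣ D.maninConstant)
    (htam : ¬ 3 ∣ W.tamagawaProduct) {q : ℚ} (hq : shaAn W = (q : ℂ))
    (hv : padicValRat 3 q = 0) : BSDp W 3 := by
  haveI : Fact (Nat.Prime 3) := ⟨Nat.prime_three⟩
  have h9 : W.HasSurjectiveModNGaloisRep 9 := by
    simpa using ClassX4M.towerSurj_of_surj hX hsurj 2
  exact X4RankZero.bsdp_three_of_kimNakamura_of_shaAn_unit W hKN hGZK hmod hr hX.classX4 h9 hexc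
    hmult D hc htam hq hv

/-- **§2, `j`-form** (`3 ∤ ord₃ j ⟹` surj(3)). [cite: KimNakamura2020, Thm. 1.7 and Rem. 1.8 (1) (arXiv p. 4)]
[cite: SilvermanATAEC1994, V.6 Prop. 6.1 (p. 410) and V.5.3] [cite: Miller2011LMS, §1 and Def. 1.1] -/
theorem ClassX4M.bsdp_three_rankZero_of_kimNakamura_of_not_dvd_padicValRat_j_of_shaAn_unit
    (hKN : KimNakamura2020.rankZero_padicValNat_sha_le_of_maninConstant)
    (hGZK : rank_eq_analyticRank_of_analyticRank_le_one) (hmod : hasEntireLFunction_rat)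
    (hX : ClassX4M W 3) (hj : ¬ (3 : ℤ) ∣ padicValRat 3 W.j) (hr : W.analyticRank = 0)
    (hexc : KimNakamura2020.NonExceptional W 3)
    (hmult : ∀ (ℓ : ℕ) [Fact ℓ.Prime], W.HasMultiplicativeReductionAtPrime ℓ →
      (W.HasSplitMultiplicativeReductionAtPrime ℓ → ¬ 3 ∣ ℓ - 1) ∧
        (¬ W.HasSplitMultiplicativeReductionAtPrime ℓ → ¬ 3 ∣ ℓ + 1))
    {N : ℕ} [NeZero N] (D : ModularParametrizationData W N) (hc : ¬ (3 : ℤ) ∣ D.maninConstant)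
    (htam : ¬ 3 ∣ W.tamagawaProduct) {q : ℚ} (hq : shaAn W = (q : ℂ))
    (hv : padicValRat 3 q = 0) : BSDp W 3 :=
  haveI : Fact (Nat.Prime 3) := ⟨Nat.prime_three⟩
  hX.bsdp_three_rankZero_of_kimNakamura_of_surj_of_shaAn_unit hKN hGZK hmod
    (ClassX4M.surj_of_not_dvd_padicValRat_j hX (by exact_mod_cast hj)) hr hexc hmult D hc htam hq hv

/-- **§2, Manin-free form** (`3 ∤ deg φ` for any conductor-level parametrisation, `hCNS` = A159).
[cite: CesnaviciusNeururerSaha2023, Thm. 1.2] [cite: KimNakamura2020, Thm. 1.7 and Rem. 1.8 (1) (arXiv p. 4)]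
[cite: Miller2011LMS, §1 and Def. 1.1] -/
theorem ClassX4M.bsdp_three_rankZero_of_kimNakamura_of_surj_of_not_dvd_modularDegree_of_shaAn_unit
    (hKN : KimNakamura2020.rankZero_padicValNat_sha_le_of_maninConstant)
    (hCNS : cesnaviciusNeururerSaha_padicVal_maninConstant_le_modularDegree)
    (hGZK : rank_eq_analyticRank_of_analyticRank_le_one) (hmod : hasEntireLFunction_rat)
    (hX : ClassX4M W 3) (hsurj : Surj W 3) (hr : W.analyticRank = 0)
    (hexc : KimNakamura2020.NonExceptional W 3)
    (hmult : ∀ (ℓ : ℕ) [Fact ℓ.Prime], W.HasMultiplicativeReductionAtPrime ℓ →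
      (W.HasSplitMultiplicativeReductionAtPrime ℓ → ¬ 3 ∣ ℓ - 1) ∧
        (¬ W.HasSplitMultiplicativeReductionAtPrime ℓ → ¬ 3 ∣ ℓ + 1))
    [NeZero (W.conductorNorm ℤ)] (D : ModularParametrizationData W (W.conductorNorm ℤ))
    (hdeg : ¬ 3 ∣ D.modularDegree) (htam : ¬ 3 ∣ W.tamagawaProduct) {q : ℚ}
    (hq : shaAn W = (q : ℂ)) (hv : padicValRat 3 q = 0) : BSDp W 3 :=
  haveI : Fact (Nat.Prime 3) := ⟨Nat.prime_three⟩
  hX.bsdp_three_rankZero_of_kimNakamura_of_surj_of_shaAn_unit hKN hGZK hmod hsurj hr hexc hmult D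
    (ClassX4M.not_dvd_maninConstant_of_not_dvd_modularDegree hCNS D hX hdeg) htam hq hv

/-- **X4(M) ∧ surj(3) ∧ `r_an = 0`, the `3 ∣ #Ш_an` rows on the KN20 locus: `ord₃ #Ш_an = q` with
`ord₃ q ≤ 2k` and ONE descent certificate `3^{2k−1} ∣ #Ш(E)` ⟹ `BSD(E,3)`** — upper half §1, lower
half Cassels–Tate squareness (`hCT` = bsd.S18) on the certificate
(`Typed.missingLowerBoundAt_of_casselsTate_of_pow_dvd`); `k = 1`: one nonzero `x ∈ Ш(E)[3]`.
[cite: KimNakamura2020, Thm. 1.7 and Rem. 1.8 (1) (arXiv p. 4)] [cite: SilvermanAEC2009, Thm. X.4.14]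
[cite: Miller2011LMS, §1 and Def. 1.1] -/
theorem ClassX4M.bsdp_three_rankZero_of_kimNakamura_of_surj_of_casselsTate_of_pow_dvd
    (hKN : KimNakamura2020.rankZero_padicValNat_sha_le_of_maninConstant)
    (hGZK : rank_eq_analyticRank_of_analyticRank_le_one) (hmod : hasEntireLFunction_rat)
    (hCT : exists_casselsTate_pairing (K := ℚ))
    (hX : ClassX4M W 3) (hsurj : Surj W 3) (hr : W.analyticRank = 0)
    (hexc : KimNakamura2020.NonExceptional W 3)
    (hmult : ∀ (ℓ : ℕ) [Fact ℓ.Prime], W.HasMultiplicativeReductionAtPrime ℓ →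
      (W.HasSplitMultiplicativeReductionAtPrime ℓ → ¬ 3 ∣ ℓ - 1) ∧
        (¬ W.HasSplitMultiplicativeReductionAtPrime ℓ → ¬ 3 ∣ ℓ + 1))
    {N : ℕ} [NeZero N] (D : ModularParametrizationData W N) (hc : ¬ (3 : ℤ) ∣ D.maninConstant)
    (htam : ¬ 3 ∣ W.tamagawaProduct) {q : ℚ} (hq : shaAn W = (q : ℂ)) {k : ℕ}
    (hv : padicValRat 3 q ≤ 2 * k) (hdvd : 3 ^ (2 * k - 1) ∣ W.shaOrder) : BSDp W 3 :=
  haveI : Fact (Nat.Prime 3) := ⟨Nat.prime_three⟩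
  X4RankZero.bsdp_three_of_kimNakamura_of_casselsTate W hKN hGZK hmod hCT hr hX.classX4
    (ClassX4M.towerSurj_of_surj hX hsurj) hexc hmult D hc htam hq hv hdvd

/-! ### §3 What is left on the KN20 locus of X4(M) is the LOWER half -/

/-- **On X4(M) ∧ surj(3) ∧ `r_an = 0` with the KN20 per-pair binders, the sub-cell's typed input
`MissingPPartAt W 3` is EQUIVALENT to its LOWER half `MissingLowerBoundAt W 3`** (the upper half being
§1) — the same shape as the Delbourgo–Kato road's `ClassX4M.missingInputAt_iff_lower_three_rankZero`,
now from Kim–Nakamura. [cite: KimNakamura2020, Thm. 1.7 and Rem. 1.8 (1) (arXiv p. 4)] [cite: Miller2011LMS, Def. 1.1] -/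
theorem ClassX4M.missingPPartAt_iff_lower_three_rankZero_of_kimNakamura_of_surj
    (hKN : KimNakamura2020.rankZero_padicValNat_sha_le_of_maninConstant)
    (hGZK : rank_eq_analyticRank_of_analyticRank_le_one) (hmod : hasEntireLFunction_rat)
    (hX : ClassX4M W 3) (hsurj : Surj W 3) (hr : W.analyticRank = 0)
    (hexc : KimNakamura2020.NonExceptional W 3)
    (hmult : ∀ (ℓ : ℕ) [Fact ℓ.Prime], W.HasMultiplicativeReductionAtPrime ℓ →
      (W.HasSplitMultiplicativeReductionAtPrime ℓ → ¬ 3 ∣ ℓ - 1) ∧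
        (¬ W.HasSplitMultiplicativeReductionAtPrime ℓ → ¬ 3 ∣ ℓ + 1))
    {N : ℕ} [NeZero N] (D : ModularParametrizationData W N) (hc : ¬ (3 : ℤ) ∣ D.maninConstant)
    (htam : ¬ 3 ∣ W.tamagawaProduct) : MissingPPartAt W 3 ↔ MissingLowerBoundAt W 3 :=
  haveI : Fact (Nat.Prime 3) := ⟨Nat.prime_three⟩
  ⟨fun h => (lower_and_upper_of_missingPPartAt W 3 h).1,
    fun hl => missingPPartAt_of_lower_of_upper W 3 hl
      (hX.missingUpperBoundAt_three_rankZero_of_kimNakamura_of_surj hKN hGZK hmod hsurj hr hexc hmult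
        D hc htam)⟩

/-- **Hence `BSD(E,3)` on that locus from the LOWER half alone** (GZK for `r_an ≤ 1 ⇒ BSD(E,3)` from
`MissingPPartAt`). [cite: KimNakamura2020, Thm. 1.7 and Rem. 1.8 (1) (arXiv p. 4)] [cite: Miller2011LMS, §1 and Def. 1.1] -/
theorem ClassX4M.bsdp_three_rankZero_of_kimNakamura_of_surj_of_lower
    (hKN : KimNakamura2020.rankZero_padicValNat_sha_le_of_maninConstant)
    (hGZK : rank_eq_analyticRank_of_analyticRank_le_one) (hmod : hasEntireLFunction_rat)
    (hX : ClassX4M W 3) (hsurj : Surj W 3) (hr : W.analyticRank = 0)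
    (hexc : KimNakamura2020.NonExceptional W 3)
    (hmult : ∀ (ℓ : ℕ) [Fact ℓ.Prime], W.HasMultiplicativeReductionAtPrime ℓ →
      (W.HasSplitMultiplicativeReductionAtPrime ℓ → ¬ 3 ∣ ℓ - 1) ∧
        (¬ W.HasSplitMultiplicativeReductionAtPrime ℓ → ¬ 3 ∣ ℓ + 1))
    {N : ℕ} [NeZero N] (D : ModularParametrizationData W N) (hc : ¬ (3 : ℤ) ∣ D.maninConstant)
    (htam : ¬ 3 ∣ W.tamagawaProduct) (hlow : MissingLowerBoundAt W 3) : BSDp W 3 :=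
  haveI : Fact (Nat.Prime 3) := ⟨Nat.prime_three⟩
  bsdp_of_missingPPartAt W 3 hGZK (by rw [hr]; exact zero_le_one)
    ((hX.missingPPartAt_iff_lower_three_rankZero_of_kimNakamura_of_surj hKN hGZK hmod hsurj hr hexc
      hmult D hc htam).mpr hlow)

/-! ### §4 The Cassels–Tate certificate road, MANIN-FREE (one-declaration twin of §2's
`…_of_casselsTate_of_pow_dvd` for the lane's DEG door; referee A R233.4 (a), 2026-08-22) -/

/-- **X4(M) ∧ surj(3) ∧ `r_an = 0`, the `3 ∣ #Ш_an` rows on the KN20 locus, MANIN-FREE: `ord₃ #Ш_an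
= q` with `ord₃ q ≤ 2k`, ONE descent certificate `3^{2k−1} ∣ #Ш(E)`, and `3 ∤ deg φ` for a
CONDUCTOR-LEVEL parametrisation datum `D` in place of `3 ∤ c_D` ⟹ `BSD(E,3)`.** The composition of
`ClassX4M.bsdp_three_rankZero_of_kimNakamura_of_surj_of_casselsTate_of_pow_dvd` (upper half Kim–Nakamura
A153 `hKN`, lower half Cassels–Tate squareness `hCT` on the certificate) with the gen-14 lever
`ClassX4M.not_dvd_maninConstant_of_not_dvd_modularDegree` (Česnavičius–Neururer–Saha 2024 Thm. 1.2
`hCNS` = A159 + tameness of (M): `f₃ = 2`, so the printed exceptional clause `3³ ∣ N` is void), written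
out as ONE declaration so that a lane row `T-KN20-CT-LOW` with the DEG door names a single kernel
consumer (referee A R233.4 (a)). Binders otherwise verbatim those of the MAN-door consumer.
[cite: KimNakamura2020, Thm. 1.7 and Rem. 1.8 (1) (arXiv p. 4)] [cite: CesnaviciusNeururerSaha2023, Thm. 1.2]
[cite: SilvermanAEC2009, Thm. X.4.14] [cite: Miller2011LMS, §1 and Def. 1.1] -/
theorem ClassX4M.bsdp_three_rankZero_of_kimNakamura_of_surj_of_casselsTate_of_pow_dvd_of_not_dvd_modularDegree
    (hKN : KimNakamura2020.rankZero_padicValNat_sha_le_of_maninConstant)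
    (hCNS : cesnaviciusNeururerSaha_padicVal_maninConstant_le_modularDegree)
    (hGZK : rank_eq_analyticRank_of_analyticRank_le_one) (hmod : hasEntireLFunction_rat)
    (hCT : exists_casselsTate_pairing (K := ℚ))
    (hX : ClassX4M W 3) (hsurj : Surj W 3) (hr : W.analyticRank = 0)
    (hexc : KimNakamura2020.NonExceptional W 3)
    (hmult : ∀ (ℓ : ℕ) [Fact ℓ.Prime], W.HasMultiplicativeReductionAtPrime ℓ →
      (W.HasSplitMultiplicativeReductionAtPrime ℓ → ¬ 3 ∣ ℓ - 1) ∧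
        (¬ W.HasSplitMultiplicativeReductionAtPrime ℓ → ¬ 3 ∣ ℓ + 1))
    [NeZero (W.conductorNorm ℤ)] (D : ModularParametrizationData W (W.conductorNorm ℤ))
    (hdeg : ¬ 3 ∣ D.modularDegree) (htam : ¬ 3 ∣ W.tamagawaProduct) {q : ℚ}
    (hq : shaAn W = (q : ℂ)) {k : ℕ} (hv : padicValRat 3 q ≤ 2 * k)
    (hdvd : 3 ^ (2 * k - 1) ∣ W.shaOrder) : BSDp W 3 :=
  hX.bsdp_three_rankZero_of_kimNakamura_of_surj_of_casselsTate_of_pow_dvd hKN hGZK hmod hCT hsurj hr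
    hexc hmult D (ClassX4M.not_dvd_maninConstant_of_not_dvd_modularDegree hCNS D hX hdeg) htam hq hv hdvd

/-- The same with surj(3) DECIDED by `3 ∤ ord₃ j` (`ClassX4M.surj_of_not_dvd_padicValRat_j` inside
`…towerSurj…`; the lane's `j3unit` bit) — MANIN-FREE CT road on the `3 ∤ ord₃ j` rows.
[cite: KimNakamura2020, Thm. 1.7 and Rem. 1.8 (1) (arXiv p. 4)] [cite: CesnaviciusNeururerSaha2023, Thm. 1.2]
[cite: SilvermanAEC2009, Thm. X.4.14] [cite: Miller2011LMS, §1 and Def. 1.1] -/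
theorem ClassX4M.bsdp_three_rankZero_of_kimNakamura_of_not_dvd_padicValRat_j_of_casselsTate_of_pow_dvd_of_not_dvd_modularDegree
    (hKN : KimNakamura2020.rankZero_padicValNat_sha_le_of_maninConstant)
    (hCNS : cesnaviciusNeururerSaha_padicVal_maninConstant_le_modularDegree)
    (hGZK : rank_eq_analyticRank_of_analyticRank_le_one) (hmod : hasEntireLFunction_rat)
    (hCT : exists_casselsTate_pairing (K := ℚ))
    (hX : ClassX4M W 3) (hj : ¬ (3 : ℤ) ∣ padicValRat 3 W.j) (hr : W.analyticRank = 0)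
    (hexc : KimNakamura2020.NonExceptional W 3)
    (hmult : ∀ (ℓ : ℕ) [Fact ℓ.Prime], W.HasMultiplicativeReductionAtPrime ℓ →
      (W.HasSplitMultiplicativeReductionAtPrime ℓ → ¬ 3 ∣ ℓ - 1) ∧
        (¬ W.HasSplitMultiplicativeReductionAtPrime ℓ → ¬ 3 ∣ ℓ + 1))
    [NeZero (W.conductorNorm ℤ)] (D : ModularParametrizationData W (W.conductorNorm ℤ))
    (hdeg : ¬ 3 ∣ D.modularDegree) (htam : ¬ 3 ∣ W.tamagawaProduct) {q : ℚ}
    (hq : shaAn W = (q : ℂ)) {k : ℕ} (hv : padicValRat 3 q ≤ 2 * k)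
    (hdvd : 3 ^ (2 * k - 1) ∣ W.shaOrder) : BSDp W 3 :=
  haveI : Fact (Nat.Prime 3) := ⟨Nat.prime_three⟩
  hX.bsdp_three_rankZero_of_kimNakamura_of_surj_of_casselsTate_of_pow_dvd_of_not_dvd_modularDegree hKN
    hCNS hGZK hmod hCT (ClassX4M.surj_of_not_dvd_padicValRat_j hX (by exact_mod_cast hj)) hr hexc hmult D
    hdeg htam hq hv hdvd

end ClassX4M

end Summit.BirchSwinnertonDyer.Rank1Residual.AdditivePotMult

end
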